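import Literature.MathematicalPhysics.QuantumLattice.FermionDeterminantBound
import HarnessLib

/-!
# Determinant bound for chronological products of two Gram kernels (Pedra–Salmhofer 2008)

Topic `MathematicalPhysics/QuantumLattice`; programme under the tree's fact `bgm_two_point_limit`
(`HubbardFermiLiquid.lean`) — the "Matsubara ultraviolet problem". de Siqueira Pedra–Salmhofer,
CMP 282 (2008) 797, Theorem 1.3 (with Lemma 3.9): if `C₁ = ⟨u_x, v_y⟩` and `C₂ = ⟨p_x, q_y⟩` have
Gram representations with Gram constants `γ₁, γ₂`, then the CHRONOLOGICAL combination
`M_{xy} = 1_{φ'(x) ≻ φ(y)} (C₁)_{xy} + 1_{φ'(x) ⪯ φ(y)} (C₂)_{xy}` — which in general has NO Gram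
representation with a good constant (loc. cit. Lemma 2.2: the step kernel `1_{s ≥ t}` has none on a
separable Hilbert space) — still obeys the `n!`-free determinant bound with constant `γ₁ + γ₂`.

This file proves the two-kernel case in coordinates (finite index types, bilinear pairings
`Σ_i u_a(i) v_b(i)` as in `FermionDeterminantBound`), with the slightly sharper constant
`√(‖u_a‖² + ‖p_a‖²) · √(‖v_b‖² + ‖q_b‖²)` per row/column pair (`≤ (γ₁ + γ₂)²`):

* `gibbsState_dGamma_diagonal_creation_annihilation`, `…_annihilation_creation` — the smeared
  two-point functions of the quasi-free Gibbs state of `dΓ(diagonal d)`: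
  `⟨c†(f) c(g)⟩ = Σ_i f_i g_i (1 + e^{β d_i})⁻¹`, `⟨c(g) c†(f)⟩ = Σ_i f_i g_i (1 - (1 + e^{β d_i})⁻¹)`;
* **`norm_det_chronological_le`** — for any interleaving pattern `k` (monotone, `k ≤ n`; after
  sorting rows and columns by their "times" every chronological indicator `1_{φ'(a) ≻ φ(b)}` is of
  this staircase form) and coordinate vectors `u, v` (kernel on the pattern) and `p, q` (kernel off
  the pattern),
  `|det [ a < k_b ? Σ_i u_a(i) v_b(i) : Σ_j p_a(j) q_b(j) ]| ≤ ∏_a √(‖u_a‖₂² + ‖p_a‖₂²) · ∏_b √(‖v_b‖₂² + ‖q_b‖₂²)`.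

PROOF (the Fock-space route of the tree, not the exterior-algebra calculus of loc. cit. §3): the
tree's `norm_det_interleave_le` bounds `|det [a < k_b ? ⟨c†(f_a)c(g_b)⟩_β : -⟨c(g_b)c†(f_a)⟩_β]|`
by `∏ ‖f_a‖₂ ∏ ‖g_b‖₂` for the Gibbs state of ANY `dΓ(h)` at ANY `β`. Take two copies of the
coordinates with one-body energies `-1` (occupation `w = (1+e^{-β})⁻¹ → 1`) and `+1` (occupation
`1 - w → 0`) and smearings mixing `(u, p)` resp. `(v, q)` with weights `√(w/θ)`, `√((1-w)/θ)`,
`θ = 2w - 1 = tanh(β/2)`: the two-point functions reproduce the chronological matrix EXACTLY, the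
smearing norms are `(‖u_a‖² + ‖p_a‖²)/θ`, and `β → ∞` gives the claim. Everything is PROVED; no
definition is introduced.

The many-fermion application (loc. cit. Thm 2.4: the time-ordered free propagator at inverse
temperature `β` is such a chronological combination of two Gram kernels with constants `≤ 1`,
uniformly in `β` and the volume) is `MatsubaraDeterminantBound.lean`.

## References

* W. de Siqueira Pedra, M. Salmhofer, *Determinant bounds and the Matsubara UV problem of
  many-fermion systems*, Comm. Math. Phys. 282 (2008) 797–818, Thm 1.3, Lemma 3.9, Lemma 3.11.
  [PedraSalmhofer2008]
* J. Feldman, H. Knörrer, E. Trubowitz, *Fermionic Functional Integrals and the Renormalization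
  Group*, CRM Monograph Series 16 (AMS 2002), §1.5–1.6. [FeldmanKnorrerTrubowitz2002]
-/

noncomputable section

open scoped Matrix ComplexOrder
open Finset NormedSpace Filter Topology

namespace Literature.MathematicalPhysics.QuantumLattice

/-! ### Smeared two-point functions of `dΓ(diagonal d)` -/

section TwoPoint

variable {ι : Type*} [LinearOrder ι] [Fintype ι]

/-- The Fermi matrix of a real diagonal one-body operator is diagonal:
`(1 + e^{β·diagonal d})⁻¹ = diagonal ((1 + e^{β d_i})⁻¹)`. [folklore] -/
theorem one_add_exp_smul_diagonal_inv (d : ι → ℝ) (β : ℝ) :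
    (1 + exp ((β : ℂ) • Matrix.diagonal fun i => ((d i : ℝ) : ℂ)))⁻¹ =
      Matrix.diagonal fun i => ((1 + Complex.exp (β * d i))⁻¹ : ℂ) := by
  have hexp : exp ((β : ℂ) • Matrix.diagonal fun i => ((d i : ℝ) : ℂ)) =
      Matrix.diagonal fun i => Complex.exp (β * d i) := by
    rw [← Matrix.diagonal_smul, Matrix.exp_diagonal]
    congr 1
    funext i
    rw [Pi.exp_def]
    simp [Complex.exp_eq_exp_ℂ, smul_eq_mul]
  have hsum : (1 : Matrix ι ι ℂ) + exp ((β : ℂ) • Matrix.diagonal fun i => ((d i : ℝ) : ℂ)) =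
      Matrix.diagonal fun i => (1 + Complex.exp (β * d i) : ℂ) := by
    rw [hexp, ← Matrix.diagonal_one, Matrix.diagonal_add]
  have hne : ∀ i, (1 + Complex.exp (β * d i) : ℂ) ≠ 0 := by
    intro i
    have : (1 + Complex.exp (β * d i) : ℂ) = ((1 + Real.exp (β * d i) : ℝ) : ℂ) := by
      push_cast
      rfl
    rw [this, Complex.ofReal_ne_zero]
    positivity
  rw [hsum]
  refine Matrix.inv_eq_right_inv ?_
  rw [Matrix.diagonal_mul_diagonal, ← Matrix.diagonal_one]
  congr 1
  funext i
  exact mul_inv_cancel₀ (hne i)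

/-- **Smeared two-point function of `dΓ(diagonal d)`**:
`⟨c†(f) c(g)⟩_β = Σ_i f_i g_i (1 + e^{β d_i})⁻¹` (letters linear in `f`, `g`).
Bratteli–Robinson II §5.2.4 (ideal Fermi gas). [cite: BratteliRobinsonII1997, §5.2.4] -/
theorem gibbsState_dGamma_diagonal_creation_annihilation (d : ι → ℝ) (β : ℝ) (f g : ι → ℂ) :
    Matrix.gibbsState β (dGamma (Matrix.diagonal fun i => ((d i : ℝ) : ℂ)))
        (linLetterOp (f, true) * linLetterOp (g, false)) =
      ∑ i, f i * g i * ((1 + Complex.exp (β * d i))⁻¹ : ℂ) := by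
  set h : Matrix ι ι ℂ := Matrix.diagonal fun i => ((d i : ℝ) : ℂ) with hh_def
  have hh : h.IsHermitian := by
    rw [hh_def]
    refine Matrix.isHermitian_diagonal_of_self_adjoint _ (funext fun i => ?_)
    simp [Pi.star_apply, Complex.conj_ofReal]
  have hprod : linLetterOp (f, true) * linLetterOp (g, false) =
      ∑ i, ∑ j, (f i * g j) • (creation i * annihilation j : Matrix (Finset ι) (Finset ι) ℂ) := by
    rw [linLetterOp, linLetterOp, Finset.sum_mul]
    refine Finset.sum_congr rfl fun i _ => ?_
    rw [Finset.mul_sum]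
    refine Finset.sum_congr rfl fun j _ => ?_
    rw [Matrix.smul_mul, Matrix.mul_smul, smul_smul]
    simp [letterOp]
  rw [hprod, map_sum]
  simp_rw [map_sum, map_smul, smul_eq_mul]
  have htwo : ∀ i j, Matrix.gibbsState β (dGamma h) (creation i * annihilation j) =
      if j = i then ((1 + Complex.exp (β * d i))⁻¹ : ℂ) else 0 := by
    intro i j
    have := thermalCorr_dGamma_creation_annihilation hh β i j
    rw [Matrix.thermalCorr] at this
    rw [this, hh_def, one_add_exp_smul_diagonal_inv, Matrix.diagonal_apply]
    split_ifs with hji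
    · subst hji; rfl
    · rfl
  simp_rw [htwo, mul_ite, mul_zero]
  refine Finset.sum_congr rfl fun i _ => ?_
  rw [Finset.sum_ite_eq' Finset.univ i]
  simp

/-- **Complementary smeared two-point function of `dΓ(diagonal d)`** (CAR):
`⟨c(g) c†(f)⟩_β = Σ_i f_i g_i (1 - (1 + e^{β d_i})⁻¹)`. Bratteli–Robinson II §5.2.4.
[cite: BratteliRobinsonII1997, §5.2.4] -/
theorem gibbsState_dGamma_diagonal_annihilation_creation (d : ι → ℝ) (β : ℝ) (f g : ι → ℂ) :
    Matrix.gibbsState β (dGamma (Matrix.diagonal fun i => ((d i : ℝ) : ℂ)))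
        (linLetterOp (g, false) * linLetterOp (f, true)) =
      ∑ i, f i * g i * (1 - (1 + Complex.exp (β * d i))⁻¹ : ℂ) := by
  set h : Matrix ι ι ℂ := Matrix.diagonal fun i => ((d i : ℝ) : ℂ) with hh_def
  have hh : h.IsHermitian := by
    rw [hh_def]
    refine Matrix.isHermitian_diagonal_of_self_adjoint _ (funext fun i => ?_)
    simp [Pi.star_apply, Complex.conj_ofReal]
  have hprod : linLetterOp (g, false) * linLetterOp (f, true) =
      ∑ j, ∑ i, (g j * f i) • (annihilation j * creation i : Matrix (Finset ι) (Finset ι) ℂ) := by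
    rw [linLetterOp, linLetterOp, Finset.sum_mul]
    refine Finset.sum_congr rfl fun j _ => ?_
    rw [Finset.mul_sum]
    refine Finset.sum_congr rfl fun i _ => ?_
    rw [Matrix.smul_mul, Matrix.mul_smul, smul_smul]
    simp [letterOp]
  rw [hprod, map_sum]
  simp_rw [map_sum, map_smul, smul_eq_mul]
  have htwo : ∀ i j, Matrix.gibbsState β (dGamma h) (annihilation j * creation i) =
      if i = j then (1 - (1 + Complex.exp (β * d i))⁻¹ : ℂ) else 0 := by
    intro i j
    have := thermalCorr_dGamma_annihilation_creation hh β i j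
    rw [Matrix.thermalCorr] at this
    rw [this, hh_def, one_add_exp_smul_diagonal_inv, Matrix.diagonal_apply, Matrix.one_apply]
    by_cases hij : i = j
    · subst hij; simp
    · rw [if_neg hij, if_neg (Ne.symm hij), if_neg hij, sub_zero]
  simp_rw [htwo, mul_ite, mul_zero]
  rw [Finset.sum_comm]
  refine Finset.sum_congr rfl fun i _ => ?_
  rw [Finset.sum_ite_eq Finset.univ i]
  simp only [Finset.mem_univ, if_true]
  ring

end TwoPoint

/-! ### The chronological determinant bound -/

section Chrono

variable {ι₁ ι₂ : Type*} [Fintype ι₁] [Fintype ι₂]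

/-- Scalar bookkeeping for the two-temperature-block realisation: with `w₁ = (1+e^{-t})⁻¹`,
`w₂ = (1+e^{t})⁻¹`, `θ = w₁ - w₂` one has `w₂ = 1 - w₁`, `θ > 0` for `t > 0`,
`(w₁/θ)w₁ - (w₂/θ)w₂ = 1`, `(w₂/θ)w₁ - (w₁/θ)w₂ = 0`, `w₁/θ + w₂/θ = 1/θ`. [folklore] -/
theorem fermiWeights_aux {t : ℝ} (ht : 0 < t) :
    (1 + Real.exp t)⁻¹ = 1 - (1 + Real.exp (-t))⁻¹ ∧
    0 < (1 + Real.exp (-t))⁻¹ - (1 + Real.exp t)⁻¹ ∧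
    0 ≤ (1 + Real.exp (-t))⁻¹ ∧ 0 ≤ (1 + Real.exp t)⁻¹ := by
  have h1 : 0 < 1 + Real.exp t := by positivity
  have h2 : 0 < 1 + Real.exp (-t) := by positivity
  have hprod : Real.exp t * Real.exp (-t) = 1 := by rw [← Real.exp_add, add_neg_cancel, Real.exp_zero]
  refine ⟨?_, ?_, by positivity, by positivity⟩
  · have hpos : 0 < Real.exp t := Real.exp_pos t
    rw [Real.exp_neg]
    field_simp
    ring
  · rw [sub_pos, inv_lt_inv₀ h1 h2, add_lt_add_iff_left]
    exact Real.exp_lt_exp.mpr (by linarith)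

/-- The block weights tend to `1`: `(1+e^{-t})⁻¹ - (1+e^{t})⁻¹ → 1` as `t → ∞`. [folklore] -/
theorem tendsto_fermiWeights_sub :
    Tendsto (fun t : ℝ => (1 + Real.exp (-t))⁻¹ - (1 + Real.exp t)⁻¹) atTop (𝓝 1) := by
  have h1 : Tendsto (fun t : ℝ => (1 + Real.exp (-t))⁻¹) atTop (𝓝 1) := by
    have : Tendsto (fun t : ℝ => 1 + Real.exp (-t)) atTop (𝓝 (1 + 0)) :=
      tendsto_const_nhds.add (Real.tendsto_exp_neg_atTop_nhds_zero)
    simpa using this.inv₀ (by norm_num)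
  have h2 : Tendsto (fun t : ℝ => (1 + Real.exp t)⁻¹) atTop (𝓝 0) := by
    have : Tendsto (fun t : ℝ => 1 + Real.exp t) atTop atTop :=
      tendsto_atTop_add_const_left _ _ Real.tendsto_exp_atTop
    exact this.inv_tendsto_atTop
  simpa using h1.sub h2

/-- **Determinant bound for the chronological combination of two Gram kernels**
(de Siqueira Pedra–Salmhofer 2008, Thm 1.3 with Lemma 3.9, two-kernel case, coordinates, bilinear
pairings). For an interleaving pattern `k` (monotone, `k_b ≤ n`) and coordinate vectors
`u_a, v_b : ι₁ → ℂ` (the kernel ON the pattern `a < k_b`) and `p_a, q_b : ι₂ → ℂ` (the kernel OFF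
the pattern),
`|det [ a < k_b ? Σ_i u_a(i) v_b(i) : Σ_j p_a(j) q_b(j) ]| ≤ ∏_a √(‖u_a‖₂² + ‖p_a‖₂²) · ∏_b √(‖v_b‖₂² + ‖q_b‖₂²)`
— no `n!`, although the matrix is NOT a Gram matrix. Proof: realise the matrix EXACTLY as the
time-ordered two-point matrix of `norm_det_interleave_le` for `dΓ` of two copies of the coordinates
at one-body energies `∓1` and inverse temperature `t`, with smearings of squared norm
`(‖u_a‖² + ‖p_a‖²)/θ(t)`, `θ(t) = tanh(t/2)`, and let `t → ∞`.
[cite: PedraSalmhofer2008, Thm 1.3 and Lemma 3.9] -/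
theorem norm_det_chronological_le {n : ℕ} (u v : Fin n → ι₁ → ℂ) (p q : Fin n → ι₂ → ℂ)
    (k : Fin n → ℕ) (hk : Monotone k) (hkn : ∀ b, k b ≤ n) :
    ‖(Matrix.of fun a b : Fin n =>
        if (a : ℕ) < k b then ∑ i, u a i * v b i else ∑ j, p a j * q b j).det‖ ≤
      (∏ a, Real.sqrt (∑ i, ‖u a i‖ ^ 2 + ∑ j, ‖p a j‖ ^ 2)) *
        ∏ b, Real.sqrt (∑ i, ‖v b i‖ ^ 2 + ∑ j, ‖q b j‖ ^ 2) := by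
  -- the coordinate type of the realisation: two copies (blocks `s = 0, 1`) of `ι₁ ⊕ ι₂`
  set K : Type _ := (ι₁ ⊕ ι₂) × Fin 2 with hK
  letI : LinearOrder K := LinearOrder.lift' (Fintype.equivFin K) (Fintype.equivFin K).injective
  set M : Matrix (Fin n) (Fin n) ℂ := Matrix.of fun a b : Fin n =>
    if (a : ℕ) < k b then ∑ i, u a i * v b i else ∑ j, p a j * q b j with hM
  set A : Fin n → ℝ := fun a => ∑ i, ‖u a i‖ ^ 2 + ∑ j, ‖p a j‖ ^ 2 with hA
  set B : Fin n → ℝ := fun b => ∑ i, ‖v b i‖ ^ 2 + ∑ j, ‖q b j‖ ^ 2 with hB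
  have hA0 : ∀ a, 0 ≤ A a := fun a => by positivity
  have hB0 : ∀ b, 0 ≤ B b := fun b => by positivity
  -- one-body energies: `-1` on block `0`, `+1` on block `1`
  set dd : K → ℝ := fun x => if x.2 = 0 then -1 else 1 with hdd
  -- the bound at "inverse temperature" `t > 0`
  have key : ∀ t : ℝ, 0 < t →
      ‖M.det‖ ≤ (∏ a, Real.sqrt (A a / ((1 + Real.exp (-t))⁻¹ - (1 + Real.exp t)⁻¹))) *
        ∏ b, Real.sqrt (B b / ((1 + Real.exp (-t))⁻¹ - (1 + Real.exp t)⁻¹)) := by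
    intro t ht
    obtain ⟨hw21, hθ, hw1, hw2⟩ := fermiWeights_aux ht
    set w₁ : ℝ := (1 + Real.exp (-t))⁻¹ with hw₁
    set w₂ : ℝ := (1 + Real.exp t)⁻¹ with hw₂
    set θ : ℝ := w₁ - w₂ with hθdef
    set α : ℝ := Real.sqrt (w₁ / θ) with hα
    set γ : ℝ := Real.sqrt (w₂ / θ) with hγ
    have hαsq : α * α = w₁ / θ := Real.mul_self_sqrt (div_nonneg hw1 hθ.le)
    have hγsq : γ * γ = w₂ / θ := Real.mul_self_sqrt (div_nonneg hw2 hθ.le)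
    have hθne : θ ≠ 0 := hθ.ne'
    -- scalar identities (real)
    have S1 : α * α * w₁ - γ * γ * w₂ = 1 := by
      rw [hαsq, hγsq, div_mul_eq_mul_div, div_mul_eq_mul_div, ← sub_div, div_eq_one_iff_eq hθne,
        hθdef, hw21]
      ring
    have S2 : γ * γ * w₁ - α * α * w₂ = 0 := by
      rw [hαsq, hγsq, div_mul_eq_mul_div, div_mul_eq_mul_div, ← sub_div,
        show w₂ * w₁ - w₁ * w₂ = 0 by ring, zero_div]
    have S5 : α * α + γ * γ = 1 / θ := by
      rw [hαsq, hγsq, ← add_div, show w₁ + w₂ = 1 by rw [hw21]; ring]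
    -- complex casts of the scalar identities
    have S1c : (α : ℂ) * α * w₁ - (γ : ℂ) * γ * w₂ = 1 := by exact_mod_cast S1
    have S2c : (γ : ℂ) * γ * w₁ - (α : ℂ) * α * w₂ = 0 := by exact_mod_cast S2
    have S3c : (α : ℂ) * α * (1 - w₁) - (γ : ℂ) * γ * (1 - w₂) = 0 := by
      have : (w₂ : ℂ) = 1 - w₁ := by exact_mod_cast hw21
      linear_combination (-1 : ℂ) * S2c + ((γ : ℂ) * γ - α * α) * this
    have S4c : (γ : ℂ) * γ * (1 - w₁) - (α : ℂ) * α * (1 - w₂) = -1 := by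
      have : (w₂ : ℂ) = 1 - w₁ := by exact_mod_cast hw21
      linear_combination (-1 : ℂ) * S1c + ((α : ℂ) * α - γ * γ) * this
    -- smearings
    set cU : Fin 2 → ℂ := fun s => if s = 0 then (α : ℂ) else γ with hcU
    set cP : Fin 2 → ℂ := fun s => if s = 0 then (γ : ℂ) else α with hcP
    set sg : Fin 2 → ℂ := fun s => if s = 0 then 1 else -1 with hsg
    set f : Fin n → K → ℂ := fun a x => Sum.elim (fun i => cU x.2 * u a i) (fun j => cP x.2 * p a j) x.1
      with hf
    set g : Fin n → K → ℂ := fun b x =>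
      Sum.elim (fun i => sg x.2 * cU x.2 * v b i) (fun j => sg x.2 * cP x.2 * q b j) x.1 with hg
    -- the one-body operator and its occupation numbers
    set h : Matrix K K ℂ := Matrix.diagonal fun x => ((dd x : ℝ) : ℂ) with hh
    have hherm : h.IsHermitian := by
      rw [hh]
      refine Matrix.isHermitian_diagonal_of_self_adjoint _ (funext fun x => ?_)
      simp [Pi.star_apply, Complex.conj_ofReal]
    have hW : ∀ x : K, ((1 + Complex.exp (t * dd x))⁻¹ : ℂ) = if x.2 = 0 then (w₁ : ℂ) else (w₂ : ℂ) := by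
      intro x
      rw [hdd]
      by_cases hx : x.2 = 0
      · simp only [hx, if_true, hw₁]
        push_cast
        ring_nf
      · simp only [hx, if_false, hw₂]
        push_cast
        ring_nf
    -- the entries: ON the pattern
    have hon : ∀ a b, Matrix.gibbsState t (dGamma h) (linLetterOp (f a, true) * linLetterOp (g b, false)) =
        ∑ i, u a i * v b i := by
      intro a b
      rw [hh, gibbsState_dGamma_diagonal_creation_annihilation]
      simp_rw [hW]
      rw [Fintype.sum_prod_type, Fintype.sum_sum_type]
      simp only [hf, hg, Sum.elim_inl, Sum.elim_inr, Fin.sum_univ_two, hcU, hcP, hsg, Fin.isValue,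
        if_true, if_false, show (1 : Fin 2) ≠ 0 from by decide]
      have e1 : ∀ z z' : ℂ, (α : ℂ) * z * (1 * α * z') * w₁ + (γ : ℂ) * z * (-1 * γ * z') * w₂ = z * z' := by
        intro z z'; linear_combination (z * z') * S1c
      have e2 : ∀ z z' : ℂ, (γ : ℂ) * z * (1 * γ * z') * w₁ + (α : ℂ) * z * (-1 * α * z') * w₂ = 0 := by
        intro z z'; linear_combination (z * z') * S2c
      simp only [e1, e2, Finset.sum_const_zero, add_zero]
    -- the entries: OFF the pattern
    have hoff : ∀ a b, -Matrix.gibbsState t (dGamma h) (linLetterOp (g b, false) * linLetterOp (f a, true)) =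
        ∑ j, p a j * q b j := by
      intro a b
      rw [hh, gibbsState_dGamma_diagonal_annihilation_creation]
      simp_rw [hW]
      rw [Fintype.sum_prod_type, Fintype.sum_sum_type]
      simp only [hf, hg, Sum.elim_inl, Sum.elim_inr, Fin.sum_univ_two, hcU, hcP, hsg, Fin.isValue,
        if_true, if_false, show (1 : Fin 2) ≠ 0 from by decide]
      have e3 : ∀ z z' : ℂ, (α : ℂ) * z * (1 * α * z') * (1 - w₁) + (γ : ℂ) * z * (-1 * γ * z') * (1 - w₂) = 0 := by
        intro z z'; linear_combination (z * z') * S3c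
      have e4 : ∀ z z' : ℂ, (γ : ℂ) * z * (1 * γ * z') * (1 - w₁) + (α : ℂ) * z * (-1 * α * z') * (1 - w₂) = -(z * z') := by
        intro z z'; linear_combination (z * z') * S4c
      simp only [e3, e4, Finset.sum_const_zero, zero_add, Finset.sum_neg_distrib, neg_neg]
    -- the realisation
    have hreal : M = Matrix.of fun a b : Fin n =>
        if (a : ℕ) < k b then
          Matrix.gibbsState t (dGamma h) (linLetterOp (f a, true) * linLetterOp (g b, false))
        else -Matrix.gibbsState t (dGamma h) (linLetterOp (g b, false) * linLetterOp (f a, true)) := by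
      ext a b
      simp only [hM, Matrix.of_apply, hon, hoff]
    -- norms of the smearings
    have hnf : ∀ a, ∑ x, ‖f a x‖ ^ 2 = A a / θ := by
      intro a
      rw [Fintype.sum_prod_type, Fintype.sum_sum_type]
      simp only [hf, Sum.elim_inl, Sum.elim_inr, Fin.sum_univ_two, hcU, hcP, Fin.isValue, if_true,
        if_false, show (1 : Fin 2) ≠ 0 from by decide, norm_mul, Complex.norm_real,
        Real.norm_eq_abs, mul_pow, sq_abs]
      have hα2 : α ^ 2 = w₁ / θ := by rw [sq, hαsq]
      have hγ2 : γ ^ 2 = w₂ / θ := by rw [sq, hγsq]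
      simp only [hα2, hγ2, ← add_mul, hA]
      rw [show w₁ / θ + w₂ / θ = 1 / θ from by rw [hw21]; field_simp; ring,
        show w₂ / θ + w₁ / θ = 1 / θ from by rw [hw21]; field_simp; ring]
      rw [← Finset.mul_sum, ← Finset.mul_sum]
      ring
    have hng : ∀ b, ∑ x, ‖g b x‖ ^ 2 = B b / θ := by
      intro b
      rw [Fintype.sum_prod_type, Fintype.sum_sum_type]
      simp only [hg, Sum.elim_inl, Sum.elim_inr, Fin.sum_univ_two, hcU, hcP, hsg, Fin.isValue, if_true,
        if_false, show (1 : Fin 2) ≠ 0 from by decide, norm_mul, Complex.norm_real,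
        Real.norm_eq_abs, mul_pow, sq_abs, norm_neg, norm_one, one_pow, one_mul]
      have hα2 : α ^ 2 = w₁ / θ := by rw [sq, hαsq]
      have hγ2 : γ ^ 2 = w₂ / θ := by rw [sq, hγsq]
      simp only [hα2, hγ2, ← add_mul, hB]
      rw [show w₁ / θ + w₂ / θ = 1 / θ from by rw [hw21]; field_simp; ring,
        show w₂ / θ + w₁ / θ = 1 / θ from by rw [hw21]; field_simp; ring]
      rw [← Finset.mul_sum, ← Finset.mul_sum]
      ring
    have hbound := norm_det_interleave_le hherm t f g k hk hkn
    have hdet : ‖M.det‖ = ‖(Matrix.of fun a b : Fin n =>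
        if (a : ℕ) < k b then
          Matrix.gibbsState t (dGamma h) (linLetterOp (f a, true) * linLetterOp (g b, false))
        else -Matrix.gibbsState t (dGamma h) (linLetterOp (g b, false) * linLetterOp (f a, true))).det‖ := by
      rw [hreal]
    rw [hdet]
    refine hbound.trans (le_of_eq ?_)
    simp only [hnf, hng]
  -- let `t → ∞`
  have hlim : Tendsto (fun t : ℝ => (∏ a, Real.sqrt (A a / ((1 + Real.exp (-t))⁻¹ - (1 + Real.exp t)⁻¹))) *
      ∏ b, Real.sqrt (B b / ((1 + Real.exp (-t))⁻¹ - (1 + Real.exp t)⁻¹))) atTop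
      (𝓝 ((∏ a, Real.sqrt (A a)) * ∏ b, Real.sqrt (B b))) := by
    have hθ := tendsto_fermiWeights_sub
    refine Tendsto.mul ?_ ?_
    · refine tendsto_finsetProd _ fun a _ => ?_
      have h1 : Tendsto (fun t : ℝ => A a / ((1 + Real.exp (-t))⁻¹ - (1 + Real.exp t)⁻¹)) atTop
          (𝓝 (A a / 1)) := (tendsto_const_nhds (x := A a)).div hθ one_ne_zero
      rw [div_one] at h1
      exact h1.sqrt
    · refine tendsto_finsetProd _ fun b _ => ?_
      have h1 : Tendsto (fun t : ℝ => B b / ((1 + Real.exp (-t))⁻¹ - (1 + Real.exp t)⁻¹)) atTop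
          (𝓝 (B b / 1)) := (tendsto_const_nhds (x := B b)).div hθ one_ne_zero
      rw [div_one] at h1
      exact h1.sqrt
  exact ge_of_tendsto hlim (Filter.eventually_atTop.2 ⟨1, fun t ht => key t (by linarith)⟩)

end Chrono

end Literature.MathematicalPhysics.QuantumLattice
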